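import Summits.BirchSwinnertonDyer.BirchSwinnertonDyer.Theses.GenusKolyvaginAtTwo
import Summits.BirchSwinnertonDyer.BirchSwinnertonDyer.Theorems.TwoAdicConverseRankOneTwoConverseOfConjAOfProp37
import HarnessLib

/-!
# SKELETON LINE `kolyvagin_road_off_semistable` for item 24948 `RankOneTwoConverseOffSemistableAtTwo`
# (route GenusKolyvaginAtTwo, support r203 — the corank-1 2-CONVERSE on the non-CM curves that are NEITHER good ordinary
#  NOR multiplicative at 2, i.e. good supersingular or additive at 2)

line-writer skeleton (linewriter-bsd-genuskolyattwo-1 g1, SECOND VARIANT — the line of record registered by g0 is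
`Lines/heegner_field_road_off_semistable.lean`, sha 671f7e98197b8ce7, untouched). NOT leaf progress; nothing here proves
any item; BSD is not proved by this.

THE LINE (Kolyvagin road at p = 2, replayed OFF the semistable-ordinary class). Route `KolyvaginRankRigidityAtTwo` (KRR2)
and rung S3 (`TwoAdicConverse`) run Kolyvagin's Euler-system argument at the prime 2 on the habitat
`(GoodOrd W 2 ∨ Mult W 2)`; the landed r = 1 deciding theorem
`Theorems.TwoAdicConverseOfConjA.rankOneTwoConverse_of_strongNonzeroSystem_of_rich` reads
V1′∞ → V2♭∞ → off-big-image residual → printed inputs → `RankOneTwoConverse` (19220). A CENSUS of the ≈ 45 KRR2 theorem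
files (this seat, `rg`) finds the reduction-type hypothesis `hred` DESTRUCTED in exactly two places —
`KolyvaginRankRigidityAtTwoCorankOneOfLeaf.lean:85` (leaf ⇒ corank glue) and
`KolyvaginRankRigidityAtTwoKolyvaginCorankRigidityAtTwoLowerBoundOfProp37OfBoundedDefectMult.lean:144` (a Mult-only branch)
— both DOWNSTREAM of `KolyvaginCorankLowerBoundAtTwoRich_of_prop37` (V2♭∞), `fullClassDeepeningAtTwo_of_prop37` (U2) and
`strongNonzeroSystemOfSeedTransport_proof` (glue 28085); everywhere upstream `hred` is only THREADED (`include` variables),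
and the p = 2 replacements of the odd-p inputs (admissibility `isAdmissible_pointsSubgroup_two_of_heegner`, Tamagawa killing
`stub_selmerAwayFromConductor` with its `∃ t, 2^t • c_M(n) ∈ Sel`, transversality T1 from Q2) use the Heegner hypothesis,
odd d_K and the surjective 2-adic image — NOT the reduction type at 2. Hence the cut:

* `stub_conjAOffSemistable`          — RESEARCH (XL): Kolyvagin's Conjecture A at p = 2 (KRR2's U1 `KolyvaginBoundedDefectAtTwo`,
                                        item 28083, VERBATIM with the habitat clause negated). The one genuinely open stub.
* `stub_fullClassDeepeningOffSemistable` — TRANSPORT CANDIDATE (M): KRR2's U2 `FullClassDeepeningAtTwo` (28084, landed there as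
                                        `fullClassDeepeningAtTwo_of_prop37` modulo print 23091) with the clause negated; expected to
                                        re-elaborate from the same ≈ 12 files once their `hred` binder is generalised (census above).
* `stub_richLowerBoundOffSemistable` — TRANSPORT CANDIDATE (M/L): KRR2's V2♭∞ `KolyvaginCorankLowerBoundAtTwoRich` (27984, landed
                                        there as `KolyvaginCorankLowerBoundAtTwoRich_of_prop37` modulo print 23091) with the clause
                                        negated; same census. Risk named: a local condition at v = 2 | N for ADDITIVE reduction hidden
                                        in a print-fact signature (none found by the census; the Tamagawa factor is absorbed by `2^t`).
* `stub_offBigImageOffSemistable`    — RESIDUAL (declared open problem, the twin of item 24404 off the class): corank-1 2-converse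
                                        when some ρ̄_{E,2^m} is not surjective AND E is supersingular/additive at 2. No printed engine.
* `stub_printedInputs`               — PRINT (M, provable now) = item 23951 `TwoAdicConverse.PrintedInputsRankOneAtTwo` BY NAME.

`NoTwoTorsionOverK` (24405) is DISCHARGED by the landed `twoAdicConverse_noTwoTorsionOverK_proof` (no reduction type in it).
The composition `RankOneTwoConverseOffSemistableAtTwo_of` is the KERNEL-CHECKED REPLAY of the landed r = 1 proof with the
habitat clause negated (glue 28085 inlined: level `M := c·(m+r+1)+m+1`), concluding 24948 BY NAME: it CERTIFIES that the
deciding argument of S3/KRR2 is reduction-type-free given the Kolyvagin inputs on the complementary class.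

WHY THIS VARIANT (vs. the line of record `heegner_field_road_off_semistable`): the g0 road's research stubs are over-K
2-converses ("Heegner point non-torsion from 2-Selmer corank one over K") on the supersingular / additive cells — as strong
as the item per cell, with no engine at 2 (BDP / Kobayashi ± / Castella–Wan are p odd). This variant reduces 24948 to ONE
research statement of Kolyvagin type (Conjecture A at 2, cell-free in Kolyvagin 1991) + two transports of LANDED tree proofs +
a residual, and tells a planner exactly what to re-type on KRR2 (generalise the `hred` binder of U1/U2/V2♭∞: the natural
research statements are CELL-FREE).

References: [cite: Kolyvagin1991MathAnn, §2 Conj. A, Thm. 2.2–2.3] [cite: GrossLMS1991, Prop. 3.7 (2), Prop. 6.2]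
[cite: McCallumLMS1991, §4 (5), Prop. 4.4, §5 Prop. 5.2] [cite: WZhang2014, Thm. 1.1] [cite: GrossZagier1986, I (6.1)]
[cite: HoffsteinLuo1997, Thm. 1] [cite: DokchitserDokchitser2010, Thm. 1.4].
-/

set_option autoImplicit false
-- the Cruxes namespace of this sub repeats the summit name by design (D-0017 nested layout)
set_option linter.dupNamespace false

noncomputable section

open scoped Classical

open Summit.BirchSwinnertonDyer.BirchSwinnertonDyer.Theses

namespace Summit.BirchSwinnertonDyer.BirchSwinnertonDyer.Cruxes.RankOneTwoConverseOffSemistableAtTwo.KolyvaginRoadOffSemistable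

/-- **stub (RESEARCH, XL)**: Kolyvagin's Conjecture A at p = 2 OFF the semistable-ordinary class — KRR2's U1
`KolyvaginBoundedDefectAtTwo` (item 28083) verbatim with `(GoodOrd W 2 ∨ Mult W 2)` replaced by its negation: on the big-image
Heegner habitat some Kolyvagin class of fixed depth `r` survives with bounded defect `m` at every level `M > m`.
[cite: Kolyvagin1991MathAnn, §2 Conj. A] -/
theorem stub_conjAOffSemistable :
    ∀ (W : WeierstrassCurve ℚ) [W.IsElliptic] [W.IsGloballyMinimal], ¬ W.HasCM → ¬
      (Literature.NumberTheory.EllipticCurves.Rank1Residual.GoodOrd W 2 ∨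
      Literature.NumberTheory.EllipticCurves.Rank1Residual.Mult W 2) → (∀ m : ℕ, W.HasSurjectiveModNGaloisRep
      (2 ^ m : ℕ)) → ∀ (K : Type) [Field K] [NumberField K],
      Literature.NumberTheory.EllipticCurves.IsImaginaryQuadratic K → ∀ [NeZero (W.conductorNorm ℤ)],
      Literature.NumberTheory.EllipticCurves.SatisfiesHeegnerHypothesis (W.conductorNorm ℤ) K → Odd
      (NumberField.discr K) → NumberField.discr K ≠ -3 → AddSubgroup.torsionBy (W.baseChange
      K).toAffine.Point (2 : ℤ) = ⊥ → Literature.NumberTheory.EllipticCurves.SatisfiesHeegnerHypothesis 2 K →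
      ∀ (Dt : Literature.NumberTheory.EllipticCurves.ModularForms.ModularParametrizationData W
      (W.conductorNorm ℤ)) (β : ℤ) (ι : K →+* ℂ), (4 * (W.conductorNorm ℤ : ℤ)) ∣ β ^ 2 - NumberField.discr K
      → ∃ r m : ℕ, ∀ M : ℕ, m < M → ∃ (n : ℕ) (d :
      Literature.NumberTheory.EllipticCurves.KolyvaginHeegnerData Dt β ι n),
      Literature.NumberTheory.EllipticCurves.KolyvaginDescent.KolSupp
      (Literature.NumberTheory.EllipticCurves.Zhang2014.IsKolyvaginPrime (W.conductorNorm ℤ) W K 2) n ∧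
      n.primeFactors.card = r ∧ ((M : ℕ) : ℕ∞) ≤ Literature.NumberTheory.EllipticCurves.Zhang2014.levelIndex
      W 2 n ∧ (2 ^ (M - m - 1) : ℤ) • d.kolyvaginClass Nat.prime_two M ≠ 0 := by
  sorry

/-- **stub (TRANSPORT CANDIDATE, M)**: full-class deepening at 2 OFF the semistable-ordinary class — KRR2's U2
`FullClassDeepeningAtTwo` (item 28084; landed on the habitat as `fullClassDeepeningAtTwo_of_prop37` modulo print 23091)
with the habitat clause negated. [cite: Kolyvagin1991MathAnn, §2 Thm. 2.2] [cite: GrossLMS1991, Prop. 3.7 (2)] -/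
theorem stub_fullClassDeepeningOffSemistable :
    ∀ (W : WeierstrassCurve ℚ) [W.IsElliptic] [W.IsGloballyMinimal], ¬ W.HasCM → ¬
      (Literature.NumberTheory.EllipticCurves.Rank1Residual.GoodOrd W 2 ∨
      Literature.NumberTheory.EllipticCurves.Rank1Residual.Mult W 2) → (∀ m : ℕ, W.HasSurjectiveModNGaloisRep
      (2 ^ m : ℕ)) → ∀ (K : Type) [Field K] [NumberField K],
      Literature.NumberTheory.EllipticCurves.IsImaginaryQuadratic K → ∀ [NeZero (W.conductorNorm ℤ)],
      Literature.NumberTheory.EllipticCurves.SatisfiesHeegnerHypothesis (W.conductorNorm ℤ) K → Odd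
      (NumberField.discr K) → NumberField.discr K ≠ -3 → AddSubgroup.torsionBy (W.baseChange
      K).toAffine.Point (2 : ℤ) = ⊥ → Literature.NumberTheory.EllipticCurves.SatisfiesHeegnerHypothesis 2 K →
      ∀ (Dt : Literature.NumberTheory.EllipticCurves.ModularForms.ModularParametrizationData W
      (W.conductorNorm ℤ)) (β : ℤ) (ι : K →+* ℂ), (4 * (W.conductorNorm ℤ : ℤ)) ∣ β ^ 2 - NumberField.discr K
      → ∃ c : ℕ, ∀ (θ k r m M n : ℕ) (d : Literature.NumberTheory.EllipticCurves.KolyvaginHeegnerData Dt β ι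
      n), Literature.NumberTheory.EllipticCurves.KolyvaginDescent.KolSupp
      (Literature.NumberTheory.EllipticCurves.Zhang2014.IsKolyvaginPrime (W.conductorNorm ℤ) W K 2) n →
      n.primeFactors.card = r → ((M : ℕ) : ℕ∞) ≤ Literature.NumberTheory.EllipticCurves.Zhang2014.levelIndex
      W 2 n → c * (m + r + 1) ≤ M → (2 ^ (M - m - 1) : ℤ) • d.kolyvaginClass Nat.prime_two M ≠ 0 → ∃ (n' : ℕ)
      (d' : Literature.NumberTheory.EllipticCurves.KolyvaginHeegnerData Dt β ι n') (M' : ℕ),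
      Literature.NumberTheory.EllipticCurves.KolyvaginDescent.KolSupp
      (Literature.NumberTheory.EllipticCurves.Zhang2014.IsKolyvaginPrime (W.conductorNorm ℤ) W K 2) n' ∧
      n'.primeFactors.card = r ∧ 1 ≤ M' ∧ ((θ * M' + k : ℕ) : ℕ∞) ≤
      Literature.NumberTheory.EllipticCurves.Zhang2014.levelIndex W 2 n' ∧ d'.kolyvaginClass Nat.prime_two M'
      ≠ 0 := by
  sorry

/-- **stub (TRANSPORT CANDIDATE, M/L)**: Kolyvagin's rich corank lower bound at 2 OFF the semistable-ordinary class — KRR2's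
V2♭∞ `KolyvaginCorankLowerBoundAtTwoRich` (item 27984; landed on the habitat as `KolyvaginCorankLowerBoundAtTwoRich_of_prop37`
modulo print 23091) with the habitat clause negated. [cite: Kolyvagin1991MathAnn, §2 Thm. 2.2–2.3]
[cite: McCallumLMS1991, §5 Prop. 5.2] -/
theorem stub_richLowerBoundOffSemistable :
    ∀ (W : WeierstrassCurve ℚ) [W.IsElliptic] [W.IsGloballyMinimal], ¬ W.HasCM → ¬
      (Literature.NumberTheory.EllipticCurves.Rank1Residual.GoodOrd W 2 ∨
      Literature.NumberTheory.EllipticCurves.Rank1Residual.Mult W 2) → (∀ m : ℕ, W.HasSurjectiveModNGaloisRep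
      (2 ^ m : ℕ)) → ∀ (K : Type) [Field K] [NumberField K],
      Literature.NumberTheory.EllipticCurves.IsImaginaryQuadratic K → NumberField.discr K ≠ -3 →
      NumberField.discr K ≠ -4 → ¬ ((2 : ℤ) ∣ NumberField.discr K) → ∀ [NeZero (W.conductorNorm ℤ)],
      Literature.NumberTheory.EllipticCurves.SatisfiesHeegnerHypothesis (W.conductorNorm ℤ) K → ∀ (Dt :
      Literature.NumberTheory.EllipticCurves.ModularForms.ModularParametrizationData W (W.conductorNorm ℤ))
      (β : ℤ) (ι : K →+* ℂ) (ν : ℕ), (∀ θ k : ℕ, ∃ (n : ℕ) (d :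
      Literature.NumberTheory.EllipticCurves.KolyvaginHeegnerData Dt β ι n) (M : ℕ),
      Literature.NumberTheory.EllipticCurves.KolyvaginDescent.KolSupp
      (Literature.NumberTheory.EllipticCurves.Zhang2014.IsKolyvaginPrime (W.conductorNorm ℤ) W K 2) n ∧
      n.primeFactors.card = ν ∧ 1 ≤ M ∧ ((θ * M + k : ℕ) : ℕ∞) ≤
      Literature.NumberTheory.EllipticCurves.Zhang2014.levelIndex W 2 n ∧ d.kolyvaginClass Nat.prime_two M ≠
      0) → (∀ ν' : ℕ, ν' < ν → ∃ θ k : ℕ, ∀ (n' : ℕ) (d' :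
      Literature.NumberTheory.EllipticCurves.KolyvaginHeegnerData Dt β ι n') (M' : ℕ),
      Literature.NumberTheory.EllipticCurves.KolyvaginDescent.KolSupp
      (Literature.NumberTheory.EllipticCurves.Zhang2014.IsKolyvaginPrime (W.conductorNorm ℤ) W K 2) n' → 1 ≤
      M' → ((θ * M' + k : ℕ) : ℕ∞) ≤ Literature.NumberTheory.EllipticCurves.Zhang2014.levelIndex W 2 n' →
      n'.primeFactors.card = ν' → d'.kolyvaginClass Nat.prime_two M' = 0) → (ν + 1 ≤ W.selmerCorank 2 ∨ ν + 1
      ≤ (W.quadraticTwist (NumberField.discr K : ℚ)).selmerCorank 2) := by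
  sorry

/-- **stub (RESIDUAL, declared open problem)**: the corank-1 2-converse off the big-image locus AND off the
semistable-ordinary class — the twin of item 24404 `TwoAdicConverse.RankOneTwoConverseOffBigImage` with the habitat clause
negated. No printed engine. -/
theorem stub_offBigImageOffSemistable :
    ∀ (W : WeierstrassCurve ℚ) [W.IsElliptic] [W.IsGloballyMinimal], ¬ W.HasCM → ¬
      (Literature.NumberTheory.EllipticCurves.Rank1Residual.GoodOrd W 2 ∨
      Literature.NumberTheory.EllipticCurves.Rank1Residual.Mult W 2) → ¬ (∀ m : ℕ,
      W.HasSurjectiveModNGaloisRep (2 ^ m : ℕ)) → W.selmerCorank 2 = 1 → W.analyticRank = 1 := by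
  sorry

/-- **stub (PRINT, M; provable now from Literature facts) = item 23951 BY NAME**: the printed inputs of the r = 1 branch
(modularity; Hoffstein–Luo; 2-parity; Kato–Kolyvagin finiteness; L(E/K) = L(E)·L(E^(d)); Gross–Zagier all levels;
Heegner-system record). [cite: HoffsteinLuo1997, Thm. 1] [cite: DokchitserDokchitser2010, Thm. 1.4] [cite: GrossZagier1986, I (6.1)] -/
theorem stub_printedInputs : TwoAdicConverse.PrintedInputsRankOneAtTwo := by
  sorry

/-- **Composition (kernel-checked replay, no sorry outside the five stubs)**: item 24948
`GenusKolyvaginAtTwo.RankOneTwoConverseOffSemistableAtTwo` BY NAME — the landed proof of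
`rankOneTwoConverse_of_strongNonzeroSystem_of_rich` with the habitat clause negated, glue 28085 (U1 → U2 → V1′∞) inlined,
`NoTwoTorsionOverK` discharged by its landed proof. -/
theorem RankOneTwoConverseOffSemistableAtTwo_of : GenusKolyvaginAtTwo.RankOneTwoConverseOffSemistableAtTwo := by
  have hT : TwoAdicConverse.NoTwoTorsionOverK :=
    Summit.BirchSwinnertonDyer.BirchSwinnertonDyer.Theorems.KolyvaginRankRigidity.twoAdicConverse_noTwoTorsionOverK_proof
  have hIn : TwoAdicConverse.PrintedInputsRankOneAtTwo := stub_printedInputs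
  unfold GenusKolyvaginAtTwo.RankOneTwoConverseOffSemistableAtTwo
  unfold TwoAdicConverse.PrintedInputsRankOneAtTwo at hIn
  unfold TwoAdicConverse.NoTwoTorsionOverK at hT
  intro W _ _ hCM hred hc
  by_cases hsur : (∀ m : ℕ, W.HasSurjectiveModNGaloisRep (2 ^ m : ℕ))
  swap
  · exact stub_offBigImageOffSemistable W hCM hred hsur hc
  obtain ⟨hmod, hHL, hpar, hKato, hE, hGZ, hrec⟩ := hIn
  haveI : Fact (Nat.Prime 2) := ⟨Nat.prime_two⟩
  haveI : NeZero (W.conductorNorm ℤ) := ⟨(W.conductorNorm_pos_holds).ne'⟩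
  -- root number −1 from 2-parity (Dokchitser–Dokchitser) and corank 1
  have hw : W.rootNumber = -1 := by
    have h := hpar W
    unfold Literature.NumberTheory.EllipticCurves.p_parity at h
    rw [hc, pow_one] at h
    exact h.symm
  -- Heegner field K with 2 split, d_K ≡ 1 (mod 8), and L(E^(d_K), 1) ≠ 0 (Hoffstein–Luo)
  obtain ⟨K, _, _, hK, -, hHN, hH2, hd8, hL1⟩ :=
    Literature.NumberTheory.EllipticCurves.exists_heegnerField_split_twist_ne_zero_discr_emod_eight_of_hoffsteinLuo
      hmod hHL W hw Nat.prime_two 0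
  have hodd : Odd (NumberField.discr K) := by
    rw [Int.odd_iff]; omega
  have hne3 : NumberField.discr K ≠ -3 := by omega
  have hne4 : NumberField.discr K ≠ -4 := by omega
  have h2d : ¬ ((2 : ℤ) ∣ NumberField.discr K) := by omega
  have hd : (NumberField.discr K : ℚ) ≠ 0 := by exact_mod_cast NumberField.discr_ne_zero K
  haveI := W.isElliptic_quadraticTwist hd
  -- the partner twist has L(1) ≠ 0, hence (Kolyvagin–Gross–Zagier finiteness) 2-Selmer corank 0
  obtain ⟨-, -, hfin⟩ := hKato (W.quadraticTwist (NumberField.discr K : ℚ)) hL1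
  haveI := hfin
  have hc' : (W.quadraticTwist (NumberField.discr K : ℚ)).selmerCorank 2 = 0 :=
    (W.quadraticTwist (NumberField.discr K : ℚ)).selmerCorank_eq_zero_of_finite 2
  have htor := hT W hsur K hK
  -- the FRAME (Dt, β, ι): modularity ⇒ a parametrisation datum (PROVED supply); an orientation β; any ι
  obtain ⟨fW, hfW⟩ := hmod W
  obtain ⟨Dt⟩ :=
    Literature.NumberTheory.Automorphic.nonempty_modularParametrizationData_of_isNewformOf hfW
  obtain ⟨β, hβ⟩ :=
    Literature.NumberTheory.EllipticCurves.exists_dvd_sq_sub_discr_holds (W.conductorNorm ℤ) K hK hHN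
  obtain ⟨ι⟩ := (inferInstance : Nonempty (K →+* ℂ))
  -- V1′∞ off the class from U1♯ and U2♯ (glue 28085 replayed: level M := c·(m+r+1)+m+1)
  obtain ⟨cdp, hdeep⟩ := stub_fullClassDeepeningOffSemistable W hCM hred hsur K hK hHN hodd hne3 htor hH2 Dt β ι hβ
  obtain ⟨r, m, hrm⟩ := stub_conjAOffSemistable W hCM hred hsur K hK hHN hodd hne3 htor hH2 Dt β ι hβ
  have hex : ∃ ν : ℕ, ∀ θ k : ℕ, ∃ (n : ℕ)
      (d : Literature.NumberTheory.EllipticCurves.KolyvaginHeegnerData Dt β ι n) (M : ℕ),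
      Literature.NumberTheory.EllipticCurves.KolyvaginDescent.KolSupp
        (Literature.NumberTheory.EllipticCurves.Zhang2014.IsKolyvaginPrime (W.conductorNorm ℤ) W K 2) n ∧
      n.primeFactors.card = ν ∧ 1 ≤ M ∧
      ((θ * M + k : ℕ) : ℕ∞) ≤ Literature.NumberTheory.EllipticCurves.Zhang2014.levelIndex W 2 n ∧
      d.kolyvaginClass Nat.prime_two M ≠ 0 := by
    refine ⟨r, fun θ k ↦ ?_⟩
    obtain ⟨n, d, hn, hr, hlev, hne⟩ := hrm (cdp * (m + r + 1) + m + 1) (by omega)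
    exact hdeep θ k r m (cdp * (m + r + 1) + m + 1) n d hn hr hlev (by omega) hne
  have hrich := Nat.find_spec hex
  have hbelow : ∀ ν' : ℕ, ν' < Nat.find hex → ∃ θ k : ℕ, ∀ (n' : ℕ)
      (d' : Literature.NumberTheory.EllipticCurves.KolyvaginHeegnerData Dt β ι n') (M' : ℕ),
      Literature.NumberTheory.EllipticCurves.KolyvaginDescent.KolSupp
        (Literature.NumberTheory.EllipticCurves.Zhang2014.IsKolyvaginPrime (W.conductorNorm ℤ) W K 2) n' →
      1 ≤ M' →
      ((θ * M' + k : ℕ) : ℕ∞) ≤ Literature.NumberTheory.EllipticCurves.Zhang2014.levelIndex W 2 n' →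
      n'.primeFactors.card = ν' → d'.kolyvaginClass Nat.prime_two M' = 0 := by
    intro ν' hν'
    have h := Nat.find_min hex hν'
    rw [not_forall] at h
    obtain ⟨θ, h⟩ := h
    rw [not_forall] at h
    obtain ⟨k, hθk⟩ := h
    exact ⟨θ, k, fun n' d' M' hn' hM' hle hcard ↦ by
      by_contra hne'; exact hθk ⟨n', d', M', hn', hcard, hM', hle, hne'⟩⟩
  -- V2♭∞ off the class (the ONLY use): ν + 1 ≤ c = 1 ∨ ν + 1 ≤ c′ = 0 forces ν = 0, i.e. y_K is non-torsion
  have hstruct := stub_richLowerBoundOffSemistable W hCM hred hsur K hK hne3 hne4 h2d hHN Dt β ι (Nat.find hex) hrich hbelow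
  have hν : Nat.find hex = 0 := by
    rcases hstruct with h1 | h1 <;> omega
  rw [hν] at hrich
  obtain ⟨n₀, d₀, M₀, hn₀, hν0, hM₀, -, hne₀⟩ := hrich 0 0
  have hn1 : n₀ = 1 := by
    rw [Finset.card_eq_zero, Nat.primeFactors_eq_empty] at hν0
    rcases hν0 with h0 | h1
    · exact absurd (h0 ▸ hn₀.1) not_squarefree_zero
    · exact h1
  subst hn1
  -- Gross–Zagier over K: ord_(s=1) L(E/K, s) = 1, and L(E/K) = L(E) · L(E^(d_K)) with L(E^(d_K), 1) ≠ 0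
  have hEK : Literature.NumberTheory.EllipticCurves.analyticRankEK W K = 1 :=
    Literature.NumberTheory.EllipticCurves.heegnerSystem_analyticRankEK_eq_one_of_kolyvaginClass_one_ne_zero
      (hGZ W _ K) (hrec _ W K) hK rfl hHN d₀ hne₀
  rw [Literature.NumberTheory.EllipticCurves.analyticRankEK_eq_add_of hE W K,
    Literature.NumberTheory.EllipticCurves.analyticRank_eq_zero_of_entireLFunction_one_ne_zero _ hL1,
    add_zero] at hEK
  exact hEK

end Summit.BirchSwinnertonDyer.BirchSwinnertonDyer.Cruxes.RankOneTwoConverseOffSemistableAtTwo.KolyvaginRoadOffSemistable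

end
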